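import Summits.Ventures.LatticeQCDFlow.Scaling.ClusteringFloorInPlane

/-!
HONEST FRAMING: exact (Metropolis-corrected) sampling algorithms for lattice gauge theory; figures
of merit are autocorrelation/cost numbers at stated couplings and volumes; no continuum-physics
claim.

# ClusteringFloorTwoClasses — AT EACH `β > 0` THE WHOLE FAMILY {(U′)_R, (U″) : planes, axes, cut
# widths} IS AT MOST TWO CONJECTURES: A TRANSVERSE ONE AND AN IN-PLANE ONE (lean-1 GEN-12, ours)

Venture-side (OURS). Cell `lqcd-flow` (pub-lqcd), unit `pub-lqcd-lean-1-g12`, 2026-08-23.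
THEORY-2 files its volume-law hypotheses per geometry: `Conjectures.CrossCutCorrelatorFloor d N G ρ β
R i j a` ((U′)_R: plaquettes in the `(i, j)` plane, `2R+1` apart along `a`) and
`Conjectures.ClusteringFloor d N G ρ β i j a` ((U″)).  GEN-11/12 proved, at each `β > 0`, that for a
FIXED plane and axis all of these are equivalent (`clusteringFloor_iff_crossCut_anyAxis`, `R ≥ 1`;
transverse axes also `R = 0`).  This file adds the lattice symmetries: the hyperoctahedral axis
permutations (`clusteringFloor_perm`, `crossCutCorrelatorFloor_perm`, Literature `configPerm`) and
orientation reversal (`clusteringFloor_swap`) act TRANSITIVELY on the transverse configurations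
`{(i, j, a) : i ≠ j, a ∉ {i, j}}` and on the in-plane configurations `{(i, j, a) : i ≠ j, a ∈ {i, j}}`:

* `exists_perm_apply_eq₂`, `exists_perm_apply_eq₃` — a permutation of `Fin d` carrying one pair /
  triple of distinct axes to another (three transpositions);
* `clusteringFloor_iff_of_transverse`, `crossCutCorrelatorFloor_iff_of_transverse` — any two
  TRANSVERSE configurations give equivalent (U″) / (U′)_R (every `β`, every `R`; pure symmetry);
* `clusteringFloor_iff_of_inPlane`, `crossCutCorrelatorFloor_iff_of_inPlane` — any two IN-PLANE
  configurations likewise;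
* **`crossCut_iff_clustering_transverse_class`** — for `β > 0`: (U′)_R at ANY transverse
  configuration and ANY `R` ⇔ (U″) at ANY transverse configuration;
  **`crossCut_iff_clustering_inPlane_class`** — the same for in-plane configurations, `R ≥ 1`.

So, for continuous `ρ` on a compact second-countable `G`, dimension `d` and coupling `β > 0`,
THEORY-2's ledger rows (U′) (one per `R`, plane, axis) and (U″) (one per plane, axis) collapse to AT
MOST TWO conjectures: the TRANSVERSE floor (any one representative, e.g. `ClusteringFloor … 0 1 2`,
needs `d ≥ 3`) and the IN-PLANE floor (e.g. `ClusteringFloor … 0 1 0`, `d ≥ 2`).  At strong coupling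
the transverse one is a tree theorem for `SU(N)`, `U(1)`, `U(N)` (gens 8–12); the in-plane one is open
there too.  NOT CLAIMED: any implication between the two classes; in-plane (U′)_0; `β ≤ 0`.
Literature grade (cell rule): bookkeeping of lattice symmetries; new docking only.
-/

noncomputable section

namespace Summit.Ventures.LatticeQCDFlow.Theory2.Clustering

open MeasureTheory Literature.MathematicalPhysics.QuantumFieldTheory
open Summit.Ventures.LatticeQCDFlow.Conjectures

/-! ## §1 Transitivity of axis permutations on pairs and triples of distinct axes -/

section Perm

variable {d : ℕ}

/-- A permutation of `Fin d` carrying a pair of distinct axes to another pair of distinct axes. -/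
theorem exists_perm_apply_eq₂ {i j i' j' : Fin d} (hij : i ≠ j) (hij' : i' ≠ j') :
    ∃ π : Equiv.Perm (Fin d), π i = i' ∧ π j = j' := by
  classical
  set σ₁ : Equiv.Perm (Fin d) := Equiv.swap i i' with hσ₁
  have h1i : σ₁ i = i' := by simp [hσ₁]
  have hj₁ : σ₁ j ≠ i' := fun h => hij (σ₁.injective (h1i.trans h.symm))
  set σ₂ : Equiv.Perm (Fin d) := Equiv.swap (σ₁ j) j' with hσ₂
  refine ⟨σ₁.trans σ₂, ?_, ?_⟩
  · rw [Equiv.trans_apply, h1i, hσ₂, Equiv.swap_apply_of_ne_of_ne hj₁.symm hij']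
  · rw [Equiv.trans_apply, hσ₂, Equiv.swap_apply_left]

/-- A permutation of `Fin d` carrying a triple of distinct axes to another triple of distinct axes. -/
theorem exists_perm_apply_eq₃ {i j a i' j' a' : Fin d} (hij : i ≠ j) (hai : a ≠ i) (haj : a ≠ j)
    (hij' : i' ≠ j') (hai' : a' ≠ i') (haj' : a' ≠ j') :
    ∃ π : Equiv.Perm (Fin d), π i = i' ∧ π j = j' ∧ π a = a' := by
  classical
  obtain ⟨σ, hσi, hσj⟩ := exists_perm_apply_eq₂ hij hij'
  have hσa_i : σ a ≠ i' := fun h => hai (σ.injective (h.trans hσi.symm))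
  have hσa_j : σ a ≠ j' := fun h => haj (σ.injective (h.trans hσj.symm))
  set τ : Equiv.Perm (Fin d) := Equiv.swap (σ a) a' with hτ
  refine ⟨σ.trans τ, ?_, ?_, ?_⟩
  · rw [Equiv.trans_apply, hσi, hτ, Equiv.swap_apply_of_ne_of_ne hσa_i.symm hai'.symm]
  · rw [Equiv.trans_apply, hσj, hτ, Equiv.swap_apply_of_ne_of_ne hσa_j.symm haj'.symm]
  · rw [Equiv.trans_apply, hτ, Equiv.swap_apply_left]

end Perm

/-! ## §2 Any two transverse configurations, any two in-plane configurations -/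

section Classes

variable {d N : ℕ} {G : Type} [Group G] [TopologicalSpace G] [IsTopologicalGroup G]
  [CompactSpace G] [MeasurableSpace G] [BorelSpace G] (ρ : G →* Matrix (Fin N) (Fin N) ℂ)

/-- **(U″) at any two TRANSVERSE configurations are equivalent** (every real `β`; axis
permutation). -/
theorem clusteringFloor_iff_of_transverse (hρ : Continuous ρ) {β : ℝ} {i j a i' j' a' : Fin d}
    (hij : i ≠ j) (hai : a ≠ i) (haj : a ≠ j) (hij' : i' ≠ j') (hai' : a' ≠ i') (haj' : a' ≠ j') :
    ClusteringFloor d N G ρ β i j a ↔ ClusteringFloor d N G ρ β i' j' a' := by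
  constructor
  · intro h
    obtain ⟨π, hi, hj, ha⟩ := exists_perm_apply_eq₃ hij hai haj hij' hai' haj'
    have h' := clusteringFloor_perm ρ hρ π h
    rwa [hi, hj, ha] at h'
  · intro h
    obtain ⟨π, hi, hj, ha⟩ := exists_perm_apply_eq₃ hij' hai' haj' hij hai haj
    have h' := clusteringFloor_perm ρ hρ π h
    rwa [hi, hj, ha] at h'

/-- **(U′)_R at any two TRANSVERSE configurations are equivalent** (every real `β`, every `R`). -/
theorem crossCutCorrelatorFloor_iff_of_transverse (hρ : Continuous ρ) {β : ℝ} {R : ℕ}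
    {i j a i' j' a' : Fin d} (hij : i ≠ j) (hai : a ≠ i) (haj : a ≠ j) (hij' : i' ≠ j')
    (hai' : a' ≠ i') (haj' : a' ≠ j') :
    CrossCutCorrelatorFloor d N G ρ β R i j a ↔ CrossCutCorrelatorFloor d N G ρ β R i' j' a' := by
  constructor
  · intro h
    obtain ⟨π, hi, hj, ha⟩ := exists_perm_apply_eq₃ hij hai haj hij' hai' haj'
    have h' := crossCutCorrelatorFloor_perm ρ hρ π h
    rwa [hi, hj, ha] at h'
  · intro h
    obtain ⟨π, hi, hj, ha⟩ := exists_perm_apply_eq₃ hij' hai' haj' hij hai haj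
    have h' := crossCutCorrelatorFloor_perm ρ hρ π h
    rwa [hi, hj, ha] at h'

/-- (U″) along the first axis of the plane, at any two planes. -/
theorem clusteringFloor_iff_of_inPlane_fst (hρ : Continuous ρ) {β : ℝ} {i j i' j' : Fin d}
    (hij : i ≠ j) (hij' : i' ≠ j') :
    ClusteringFloor d N G ρ β i j i ↔ ClusteringFloor d N G ρ β i' j' i' := by
  constructor
  · intro h
    obtain ⟨π, hi, hj⟩ := exists_perm_apply_eq₂ hij hij'
    have h' := clusteringFloor_perm ρ hρ π h
    rwa [hi, hj] at h'
  · intro h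
    obtain ⟨π, hi, hj⟩ := exists_perm_apply_eq₂ hij' hij
    have h' := clusteringFloor_perm ρ hρ π h
    rwa [hi, hj] at h'

/-- (U″) along either axis of the plane is the same conjecture (orientation reversal + the
transposition of the two axes). -/
theorem clusteringFloor_inPlane_snd_iff_fst (hρ : Continuous ρ) {β : ℝ} {i j : Fin d} (hij : i ≠ j) :
    ClusteringFloor d N G ρ β i j j ↔ ClusteringFloor d N G ρ β i j i :=
  ⟨fun h => (clusteringFloor_iff_of_inPlane_fst ρ hρ hij.symm hij).1 (clusteringFloor_swap ρ hρ h),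
    fun h => clusteringFloor_swap ρ hρ ((clusteringFloor_iff_of_inPlane_fst ρ hρ hij hij.symm).1 h)⟩

/-- **(U″) at any two IN-PLANE configurations are equivalent** (every real `β`). -/
theorem clusteringFloor_iff_of_inPlane (hρ : Continuous ρ) {β : ℝ} {i j a i' j' a' : Fin d}
    (hij : i ≠ j) (ha : a = i ∨ a = j) (hij' : i' ≠ j') (ha' : a' = i' ∨ a' = j') :
    ClusteringFloor d N G ρ β i j a ↔ ClusteringFloor d N G ρ β i' j' a' := by
  -- reduce both sides to the first-axis form
  have hl : ClusteringFloor d N G ρ β i j a ↔ ClusteringFloor d N G ρ β i j i := by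
    rcases ha with rfl | rfl
    · exact Iff.rfl
    · exact clusteringFloor_inPlane_snd_iff_fst ρ hρ hij
  have hr : ClusteringFloor d N G ρ β i' j' a' ↔ ClusteringFloor d N G ρ β i' j' i' := by
    rcases ha' with rfl | rfl
    · exact Iff.rfl
    · exact clusteringFloor_inPlane_snd_iff_fst ρ hρ hij'
  exact hl.trans ((clusteringFloor_iff_of_inPlane_fst ρ hρ hij hij').trans hr.symm)

/-- (U′)_R along the first axis of the plane, at any two planes. -/
theorem crossCutCorrelatorFloor_iff_of_inPlane_fst (hρ : Continuous ρ) {β : ℝ} {R : ℕ}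
    {i j i' j' : Fin d} (hij : i ≠ j) (hij' : i' ≠ j') :
    CrossCutCorrelatorFloor d N G ρ β R i j i ↔ CrossCutCorrelatorFloor d N G ρ β R i' j' i' := by
  constructor
  · intro h
    obtain ⟨π, hi, hj⟩ := exists_perm_apply_eq₂ hij hij'
    have h' := crossCutCorrelatorFloor_perm ρ hρ π h
    rwa [hi, hj] at h'
  · intro h
    obtain ⟨π, hi, hj⟩ := exists_perm_apply_eq₂ hij' hij
    have h' := crossCutCorrelatorFloor_perm ρ hρ π h
    rwa [hi, hj] at h'

/-- (U′)_R along either axis of the plane is the same conjecture. -/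
theorem crossCutCorrelatorFloor_inPlane_snd_iff_fst (hρ : Continuous ρ) {β : ℝ} {R : ℕ}
    {i j : Fin d} (hij : i ≠ j) :
    CrossCutCorrelatorFloor d N G ρ β R i j j ↔ CrossCutCorrelatorFloor d N G ρ β R i j i :=
  ⟨fun h => (crossCutCorrelatorFloor_iff_of_inPlane_fst ρ hρ hij.symm hij).1
      (crossCutCorrelatorFloor_swap ρ hρ h),
    fun h => crossCutCorrelatorFloor_swap ρ hρ
      ((crossCutCorrelatorFloor_iff_of_inPlane_fst ρ hρ hij hij.symm).1 h)⟩

/-- **(U′)_R at any two IN-PLANE configurations are equivalent** (every real `β`, every `R`). -/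
theorem crossCutCorrelatorFloor_iff_of_inPlane (hρ : Continuous ρ) {β : ℝ} {R : ℕ}
    {i j a i' j' a' : Fin d} (hij : i ≠ j) (ha : a = i ∨ a = j) (hij' : i' ≠ j')
    (ha' : a' = i' ∨ a' = j') :
    CrossCutCorrelatorFloor d N G ρ β R i j a ↔ CrossCutCorrelatorFloor d N G ρ β R i' j' a' := by
  have hl : CrossCutCorrelatorFloor d N G ρ β R i j a ↔ CrossCutCorrelatorFloor d N G ρ β R i j i := by
    rcases ha with rfl | rfl
    · exact Iff.rfl
    · exact crossCutCorrelatorFloor_inPlane_snd_iff_fst ρ hρ hij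
  have hr : CrossCutCorrelatorFloor d N G ρ β R i' j' a' ↔
      CrossCutCorrelatorFloor d N G ρ β R i' j' i' := by
    rcases ha' with rfl | rfl
    · exact Iff.rfl
    · exact crossCutCorrelatorFloor_inPlane_snd_iff_fst ρ hρ hij'
  exact hl.trans ((crossCutCorrelatorFloor_iff_of_inPlane_fst ρ hρ hij hij').trans hr.symm)

end Classes

/-! ## §3 The two classes at `β > 0` -/

section TwoClasses

variable {d N : ℕ} [NeZero d] {G : Type} [Group G] [TopologicalSpace G] [IsTopologicalGroup G]
  [CompactSpace G] [MeasurableSpace G] [BorelSpace G] [SecondCountableTopology G]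
  (ρ : G →* Matrix (Fin N) (Fin N) ℂ)

/-- **THE TRANSVERSE CLASS.**  For continuous `ρ` and `β > 0`: (U′)_R at ANY transverse
configuration `(i, j, a)`, `a ∉ {i, j}`, and ANY cut width `R` is equivalent to (U″) at ANY transverse
configuration `(i', j', a')` — one conjecture per `(G, ρ, d, β)`. -/
theorem crossCut_iff_clustering_transverse_class (hρ : Continuous ρ) {β : ℝ} (hβ : 0 < β) {R : ℕ}
    {i j a i' j' a' : Fin d} (hij : i ≠ j) (hai : a ≠ i) (haj : a ≠ j) (hij' : i' ≠ j')
    (hai' : a' ≠ i') (haj' : a' ≠ j') :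
    CrossCutCorrelatorFloor d N G ρ β R i j a ↔ ClusteringFloor d N G ρ β i' j' a' :=
  (clusteringFloor_iff_crossCut ρ hρ hβ hai haj R).symm.trans
    (clusteringFloor_iff_of_transverse ρ hρ hij hai haj hij' hai' haj')

/-- **THE IN-PLANE CLASS.**  For continuous `ρ` and `β > 0`: (U′)_R at ANY in-plane configuration
`(i, j, a)`, `a ∈ {i, j}`, and ANY cut width `R ≥ 1` is equivalent to (U″) at ANY in-plane
configuration — the second (and last) conjecture per `(G, ρ, d, β)`. -/
theorem crossCut_iff_clustering_inPlane_class (hρ : Continuous ρ) {β : ℝ} (hβ : 0 < β) {R : ℕ}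
    (hR : 1 ≤ R) {i j a i' j' a' : Fin d} (hij : i ≠ j) (ha : a = i ∨ a = j) (hij' : i' ≠ j')
    (ha' : a' = i' ∨ a' = j') :
    CrossCutCorrelatorFloor d N G ρ β R i j a ↔ ClusteringFloor d N G ρ β i' j' a' :=
  (clusteringFloor_iff_crossCut_inPlane ρ hρ hβ hij ha hR).symm.trans
    (clusteringFloor_iff_of_inPlane ρ hρ hij ha hij' ha')

/-- **EVERY (U′)_R / (U″) ITEM IS ONE OF THE TWO REPRESENTATIVES** (`β > 0`, `R ≥ 1`, `d ≥ 3` so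
that both representatives exist): for every plane `i ≠ j` and every axis `a`,
`CrossCutCorrelatorFloor d N G ρ β R i j a` is equivalent either to the transverse representative
`ClusteringFloor d N G ρ β 0 1 2` (when `a ∉ {i, j}`) or to the in-plane representative
`ClusteringFloor d N G ρ β 0 1 0` (when `a ∈ {i, j}`). -/
theorem crossCut_iff_representative (hd : 3 ≤ d) (hρ : Continuous ρ) {β : ℝ} (hβ : 0 < β) {R : ℕ}
    (hR : 1 ≤ R) {i j : Fin d} (hij : i ≠ j) (a : Fin d) :
    (a ≠ i ∧ a ≠ j ∧ (CrossCutCorrelatorFloor d N G ρ β R i j a ↔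
        ClusteringFloor d N G ρ β ⟨0, by omega⟩ ⟨1, by omega⟩ ⟨2, by omega⟩)) ∨
    ((a = i ∨ a = j) ∧ (CrossCutCorrelatorFloor d N G ρ β R i j a ↔
        ClusteringFloor d N G ρ β ⟨0, by omega⟩ ⟨1, by omega⟩ ⟨0, by omega⟩)) := by
  by_cases hai : a = i
  · exact Or.inr ⟨Or.inl hai, crossCut_iff_clustering_inPlane_class ρ hρ hβ hR hij (Or.inl hai)
      (by simp [Fin.ext_iff]) (Or.inl rfl)⟩
  · by_cases haj : a = j
    · exact Or.inr ⟨Or.inr haj, crossCut_iff_clustering_inPlane_class ρ hρ hβ hR hij (Or.inr haj)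
        (by simp [Fin.ext_iff]) (Or.inl rfl)⟩
    · exact Or.inl ⟨hai, haj, crossCut_iff_clustering_transverse_class ρ hρ hβ hij hai haj
        (by simp [Fin.ext_iff]) (by simp [Fin.ext_iff]) (by simp [Fin.ext_iff])⟩

end TwoClasses

end Summit.Ventures.LatticeQCDFlow.Theory2.Clustering
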